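import Literature.NumberTheory.Sieve.FGKMT2018MultidimensionalSieve
import HarnessLib

/-!
# FGKMT 2018 §8 — scalar bookkeeping for «Theorem 6 ⟹ Theorem 5»

Third support file for the edge «Theorem 6 ⟹ Theorem 5» of Ford–Green–Konyagin–Maynard–Tao,
*Long gaps between primes* (§8, arXiv:1412.5029v4 pp. 22–24): the elementary real-analysis facts
about the scalars of the deduction, isolated from the sieve estimates.

* `one_le_bOverPhi`, `bOverPhi_le_two`: `1 ≤ B/φ(B) ≤ 2` for `B = 1` or prime («`φ(B)/B ≍ 1`»).
* `rLevel x = (x/4)^{1/9}` (§8: `R = (x/4)^{θ/3}`, `θ = 1/3`): `log R = (log x − log 4)/9`, and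
  for all large `x` and every `X ∈ [x/2, x log² x]`: `X^{1/30} ≤ R ≤ X^{1/9}`, `1 ≤ log R`,
  `1/10 ≤ log R/log x ≤ 1/9` («`log R/log x ≍ 1`»), `rLevel_window`.
* `u_bounds`: from `J_k ≍_K (log k/k) I_k` ((7.11)), `u := (φ(B)/B)(log R/log x) · k J_k/(2 I_k)`
  satisfies `log k/(40K) ≤ u ≤ K log k` — this is (6.2′) `u ≍ log r`.
* `tau_growth`: for every `K, ε > 0` and all large `x`, uniformly in `2 ≤ k ≤ log^{1/5} x`,
  `x^{-ε} ≤ 2 e^{-Kk} K⁻¹ (2k log k)^{-k}`; with `tau_lower` this is (6.2) `τ ≥ x^{-o(1)}` for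
  `τ := 2 (B/φ(B))^k 𝔖 (log R)^k (log x)^k I_k` given `𝔖 ≥ e^{-Kk}` (Maynard Lemma 8.1(i)) and
  `I_k ≥ K⁻¹ (2k log k)^{-k}` ((7.10)).
* `rpow_half_le`: `(x/2)^{2/9+ε} ≤ x^{1/3+ε}` ((6.6) from (7.15) at `X = x/2`).

## References
* K. Ford, B. Green, S. Konyagin, J. Maynard, T. Tao, *Long gaps between primes*, J. Amer. Math.
  Soc. 31 (2018) 65–105, §8.
* J. Maynard, *Dense clusters of primes in subsets*, Compositio Math. 152 (2016), Lemma 8.1, (7.10)–(7.11).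
-/

open Filter Topology Finset

namespace Literature.NumberTheory.Sieve.FGKMT2018

/-! ### `B/φ(B)` -/

/-- `B/φ(B) ≥ 1` for `B = 1` or `B` prime. [cite: FordGreenKonyaginMaynardTao2018, §8 («φ(B)/B ≍ 1»)] -/
theorem one_le_bOverPhi {B : ℕ} (hB : B = 1 ∨ B.Prime) : 1 ≤ bOverPhi B := by
  rcases hB with rfl | hB
  · simp [bOverPhi]
  · have h2 := hB.two_le
    rw [bOverPhi, Nat.totient_prime hB, Nat.cast_sub (by omega), Nat.cast_one]
    have hBr : (2 : ℝ) ≤ B := by exact_mod_cast h2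
    rw [le_div_iff₀ (by linarith)]
    linarith

/-- `B/φ(B) ≤ 2` for `B = 1` or `B` prime. [cite: FordGreenKonyaginMaynardTao2018, §8 («φ(B)/B ≍ 1»)] -/
theorem bOverPhi_le_two {B : ℕ} (hB : B = 1 ∨ B.Prime) : bOverPhi B ≤ 2 := by
  rcases hB with rfl | hB
  · simp [bOverPhi]
  · have h2 := hB.two_le
    rw [bOverPhi, Nat.totient_prime hB, Nat.cast_sub (by omega), Nat.cast_one]
    have hBr : (2 : ℝ) ≤ B := by exact_mod_cast h2
    rw [div_le_iff₀ (by linarith)]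
    linarith

/-- `0 < B/φ(B)` for `B = 1` or `B` prime. [cite: FordGreenKonyaginMaynardTao2018, §8] -/
theorem bOverPhi_pos {B : ℕ} (hB : B = 1 ∨ B.Prime) : 0 < bOverPhi B :=
  lt_of_lt_of_le one_pos (one_le_bOverPhi hB)

/-! ### The sieve level `R = (x/4)^{1/9}` -/

/-- §8's sieve level `R = (x/4)^{θ/3}` with `θ = 1/3`. [cite: FordGreenKonyaginMaynardTao2018, §8 p. 23] -/
noncomputable def rLevel (x : ℕ) : ℝ := ((x : ℝ) / 4) ^ ((1 : ℝ) / 9)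

/-- `R > 0` (`x ≥ 1`). [cite: FordGreenKonyaginMaynardTao2018, §8] -/
theorem rLevel_pos {x : ℕ} (hx : 0 < x) : 0 < rLevel x :=
  Real.rpow_pos_of_pos (by positivity) _

/-- `log R = (log x − log 4)/9`. [cite: FordGreenKonyaginMaynardTao2018, §8] -/
theorem log_rLevel {x : ℕ} (hx : 0 < x) : Real.log (rLevel x) = (Real.log x - Real.log 4) / 9 := by
  have hx0 : (0 : ℝ) < x := by exact_mod_cast hx
  rw [rLevel, Real.log_rpow (by positivity), Real.log_div hx0.ne' (by norm_num)]
  ring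

/-- `R ≤ X^{1/9}` whenever `x/2 ≤ X`. [cite: FordGreenKonyaginMaynardTao2018, §8 (hypothesis `R ≤ x^{θ/3}` of Thm 6)] -/
theorem rLevel_le_rpow {x : ℕ} {X : ℝ} (hX : (x : ℝ) / 2 ≤ X) : rLevel x ≤ X ^ ((1 : ℝ) / 9) := by
  have hx0 : (0 : ℝ) ≤ x := Nat.cast_nonneg x
  exact Real.rpow_le_rpow (by positivity) (by linarith) (by norm_num)

/-- `X^{1/30} ≤ R` whenever `0 ≤ X ≤ x²` and `x ≥ 32`. [cite: FordGreenKonyaginMaynardTao2018, §8 (hypothesis `x^{θ/10} ≤ R` of Thm 6)] -/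
theorem rpow_le_rLevel {x : ℕ} {X : ℝ} (hx : 32 ≤ x) (hX0 : 0 ≤ X) (hX : X ≤ (x : ℝ) ^ 2) :
    X ^ ((1 : ℝ) / 30) ≤ rLevel x := by
  have hx0 : (0 : ℝ) < x := by exact_mod_cast (by omega : 0 < x)
  have hx32 : (32 : ℝ) ≤ x := by exact_mod_cast hx
  have h1 : X ^ ((1 : ℝ) / 30) ≤ ((x : ℝ) ^ 2) ^ ((1 : ℝ) / 30) :=
    Real.rpow_le_rpow hX0 hX (by norm_num)
  have h2 : ((x : ℝ) ^ 2) ^ ((1 : ℝ) / 30) = ((x : ℝ) ^ 3) ^ ((1 : ℝ) / 45) := by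
    rw [show ((x : ℝ) ^ 2) = (x : ℝ) ^ (2 : ℝ) by norm_cast,
      show ((x : ℝ) ^ 3) = (x : ℝ) ^ (3 : ℝ) by norm_cast, ← Real.rpow_mul hx0.le,
      ← Real.rpow_mul hx0.le]
    norm_num
  have h3 : rLevel x = (((x : ℝ) / 4) ^ 5) ^ ((1 : ℝ) / 45) := by
    rw [rLevel, show (((x : ℝ) / 4) ^ 5) = ((x : ℝ) / 4) ^ (5 : ℝ) by norm_cast,
      ← Real.rpow_mul (by positivity)]
    norm_num
  have h4 : (x : ℝ) ^ 3 ≤ ((x : ℝ) / 4) ^ 5 := by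
    rw [div_pow, le_div_iff₀ (by norm_num)]
    nlinarith [pow_pos hx0 3, mul_le_mul hx32 hx32 (by norm_num) hx0.le]
  rw [h3]
  exact h1.trans (h2.le.trans (Real.rpow_le_rpow (by positivity) h4 (by norm_num)))

/-- The growth facts about `x` used with `rLevel`. [cite: FordGreenKonyaginMaynardTao2018, §8 («for sufficiently large x»)] -/
theorem rLevel_window : ∀ᶠ x : ℕ in atTop, 32 ≤ x ∧ 2 ≤ Real.log x ∧ Real.log x ^ 2 ≤ (x : ℝ) ∧
    (x : ℝ) * Real.log x ^ 2 ≤ (x : ℝ) ^ 2 ∧ 1 ≤ Real.log (rLevel x) ∧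
    1 / 10 ≤ Real.log (rLevel x) / Real.log x ∧ Real.log (rLevel x) / Real.log x ≤ 1 / 9 ∧
    ∀ X : ℝ, (x : ℝ) / 2 ≤ X → X ≤ (x : ℝ) * Real.log x ^ 2 →
      X ^ ((1 : ℝ) / 30) ≤ rLevel x ∧ rLevel x ≤ X ^ ((1 : ℝ) / 9) ∧ 1 ≤ X := by
  have hℓ : Tendsto (fun x : ℕ => Real.log x) atTop atTop :=
    Real.tendsto_log_atTop.comp tendsto_natCast_atTop_atTop
  have hA : ∀ᶠ x : ℕ in atTop, (Real.log x) ^ 2 ≤ x := by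
    have h := ((Real.isLittleO_pow_log_id_atTop (n := 2)).comp_tendsto
      tendsto_natCast_atTop_atTop).bound zero_lt_one
    filter_upwards [h] with x hx
    simpa [Real.norm_eq_abs, abs_of_nonneg (sq_nonneg (Real.log (x : ℝ)))] using hx
  have hlog4 : Real.log 4 < 2 := by
    have := Real.log_two_lt_d9
    rw [show (4 : ℝ) = 2 ^ 2 by norm_num, Real.log_pow]
    norm_num
    linarith
  have hlog4' : 0 < Real.log 4 := Real.log_pos (by norm_num)
  filter_upwards [eventually_ge_atTop 32, hℓ.eventually_ge_atTop 20, hA] with x hx hL hA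
  have hx0 : (0 : ℝ) < x := by exact_mod_cast (by omega : 0 < x)
  have hL0 : 0 < Real.log x := by linarith
  have hlr := log_rLevel (x := x) (by omega)
  have hxL : (x : ℝ) * Real.log x ^ 2 ≤ (x : ℝ) ^ 2 := by
    rw [sq (x : ℝ)]
    exact mul_le_mul_of_nonneg_left hA hx0.le
  refine ⟨hx, by linarith, hA, hxL, ?_, ?_, ?_, fun X hX1 hX2 => ⟨?_, rLevel_le_rpow hX1, ?_⟩⟩
  · rw [hlr]
    linarith
  · rw [hlr, le_div_iff₀ hL0]
    linarith
  · rw [hlr, div_le_iff₀ hL0]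
    linarith
  · exact rpow_le_rLevel hx (by linarith) (hX2.trans hxL)
  · have h2x : (2 : ℝ) ≤ (x : ℝ) / 2 := by
      have : (32 : ℝ) ≤ x := by exact_mod_cast hx
      linarith
    linarith

/-! ### `u ≍ log k` -/

/-- **(6.2′) `u ≍ log r`**: with `J ≍_K (log k/k) I` ((7.11)), `1 ≤ b ≤ 2` (`b = B/φ(B)`) and
`1/10 ≤ ρ ≤ 1` (`ρ = log R/log x`), the quantity `u = b⁻¹ ρ k J/(2I)` of §8 (comparing (8.4) with
(6.4)) satisfies `log k/(40K) ≤ u ≤ K log k`. [cite: FordGreenKonyaginMaynardTao2018, §8 p. 23 («from (7.11) we thus obtain (6.2′)»)] -/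
theorem u_bounds {K I J b ρ : ℝ} {k : ℕ} (hK : 0 < K) (hk : 1 ≤ k) (hI : 0 < I)
    (hJ1 : Real.log k / k * I ≤ K * J) (hJ2 : J ≤ K * (Real.log k / k * I))
    (hb1 : 1 ≤ b) (hb2 : b ≤ 2) (hρ1 : 1 / 10 ≤ ρ) (hρ2 : ρ ≤ 1) :
    Real.log k / (40 * K) ≤ b⁻¹ * ρ * (k * J / (2 * I)) ∧
      b⁻¹ * ρ * (k * J / (2 * I)) ≤ K * Real.log k := by
  have hk0 : (0 : ℝ) < k := by exact_mod_cast hk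
  have hlk : 0 ≤ Real.log k := Real.log_nonneg (by exact_mod_cast hk)
  have hb0 : 0 < b := by linarith
  have e : b⁻¹ * ρ * (k * J / (2 * I)) = ρ * (k * J) / (2 * b * I) := by
    field_simp
  rw [e]
  have hkJ1 : Real.log k * I ≤ K * (k * J) := by
    have := mul_le_mul_of_nonneg_left hJ1 hk0.le
    rw [show (k : ℝ) * (Real.log k / k * I) = Real.log k * I by field_simp] at this
    linarith
  have hkJ2 : k * J ≤ K * Real.log k * I := by
    have := mul_le_mul_of_nonneg_left hJ2 hk0.le
    rw [show (k : ℝ) * (K * (Real.log k / k * I)) = K * Real.log k * I by field_simp] at this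
    exact this
  have hden : 0 < 2 * b * I := by positivity
  have hkJ0 : 0 ≤ K * (k * J) := le_trans (by positivity) hkJ1
  have hkJ0' : 0 ≤ (k : ℝ) * J := by
    by_contra h
    push Not at h
    have : K * (k * J) < 0 := mul_neg_of_pos_of_neg hK h
    linarith
  constructor
  · rw [div_le_div_iff₀ (by positivity) hden]
    have hb2' := mul_le_mul_of_nonneg_left hb2 (by positivity : (0 : ℝ) ≤ 2 * Real.log k * I)
    have h1 : Real.log k * (2 * b * I) ≤ 4 * (Real.log k * I) := by
      calc Real.log k * (2 * b * I) = 2 * Real.log k * I * b := by ring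
        _ ≤ 2 * Real.log k * I * 2 := hb2'
        _ = 4 * (Real.log k * I) := by ring
    have h2 : 4 * (Real.log k * I) ≤ 4 * (K * (k * J)) := by linarith
    have e2 : ρ * (k * J) * (40 * K) = 4 * (K * (k * J)) + (40 * ρ - 4) * (K * (k * J)) := by ring
    have h3 : 0 ≤ (40 * ρ - 4) * (K * (k * J)) := mul_nonneg (by linarith) hkJ0
    linarith
  · rw [div_le_iff₀ hden]
    have h1 : ρ * (k * J) ≤ 1 * (K * Real.log k * I) := mul_le_mul hρ2 hkJ2 hkJ0' zero_le_one
    have e3 : K * Real.log k * (2 * b * I) =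
        K * Real.log k * I + (2 * b - 1) * (K * Real.log k * I) := by ring
    have h4 : 0 ≤ (2 * b - 1) * (K * Real.log k * I) := mul_nonneg (by linarith) (by positivity)
    linarith

/-! ### `τ ≥ x^{-o(1)}` -/

/-- Monotonicity step of (6.2): `τ = 2 b^k 𝔖 (log R)^k (log x)^k I ≥ 2 e^{-Kk} K⁻¹ (2k log k)^{-k}`
when `b ≥ 1`, `𝔖 ≥ e^{-Kk}`, `log R, log x ≥ 1`, `K I ≥ (2k log k)^{-k}`.
[cite: FordGreenKonyaginMaynardTao2018, §8 p. 23 (proof of (6.2))] -/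
theorem tau_lower {K b S lR lx I : ℝ} {k : ℕ} (hK : 0 < K) (hb : 1 ≤ b)
    (hS : Real.exp (-(K * k)) ≤ S) (hlR : 1 ≤ lR) (hlx : 1 ≤ lx)
    (hI : (2 * (k : ℝ) * Real.log k) ^ (-(k : ℝ)) ≤ K * I) :
    2 * Real.exp (-(K * k)) * (K⁻¹ * (2 * (k : ℝ) * Real.log k) ^ (-(k : ℝ))) ≤
      2 * b ^ k * S * lR ^ k * lx ^ k * I := by
  have hE := Real.exp_pos (-(K * k))
  have hP : 0 ≤ (2 * (k : ℝ) * Real.log k) ^ (-(k : ℝ)) := by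
    apply Real.rpow_nonneg
    have : (0 : ℝ) ≤ Real.log k := by
      rcases Nat.eq_zero_or_pos k with rfl | hk
      · simp
      · exact Real.log_nonneg (by exact_mod_cast hk)
    positivity
  have hI' : K⁻¹ * (2 * (k : ℝ) * Real.log k) ^ (-(k : ℝ)) ≤ I := by
    rw [inv_mul_le_iff₀ hK]
    exact hI
  have hbk : 1 ≤ b ^ k := one_le_pow₀ hb
  have hlRk : 1 ≤ lR ^ k := one_le_pow₀ hlR
  have hlxk : 1 ≤ lx ^ k := one_le_pow₀ hlx
  have hI0 : 0 ≤ K⁻¹ * (2 * (k : ℝ) * Real.log k) ^ (-(k : ℝ)) := by positivity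
  have hS0 : 0 ≤ S := hE.le.trans hS
  have hb' : 0 < b := by linarith
  have hlR' : 0 < lR := by linarith
  have hlx' : 0 < lx := by linarith
  calc 2 * Real.exp (-(K * k)) * (K⁻¹ * (2 * (k : ℝ) * Real.log k) ^ (-(k : ℝ)))
      = 2 * 1 * Real.exp (-(K * k)) * 1 * 1 * (K⁻¹ * (2 * (k : ℝ) * Real.log k) ^ (-(k : ℝ))) := by
        ring
    _ ≤ 2 * b ^ k * S * lR ^ k * lx ^ k * I := by
        gcongr

/-- **(6.2) `τ ≥ x^{-o(1)}`, growth part**: for `K, ε > 0` and all large `x`, uniformly in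
`2 ≤ k ≤ log^{1/5} x`, `x^{-ε} ≤ 2 e^{-Kk} K⁻¹ (2k log k)^{-k}`.
[cite: FordGreenKonyaginMaynardTao2018, §8 p. 23 («𝔖 ≥ x^{-o(1)}», «I_k = x^{o(1)}»)] -/
theorem tau_growth {K : ℝ} (hK : 0 < K) {ε : ℝ} (hε : 0 < ε) :
    ∀ᶠ x : ℕ in atTop, ∀ k : ℕ, 2 ≤ k → (k : ℝ) ≤ Real.log x ^ ((1 : ℝ) / 5) →
      (x : ℝ) ^ (-ε) ≤ 2 * Real.exp (-(K * k)) * (K⁻¹ * (2 * (k : ℝ) * Real.log k) ^ (-(k : ℝ))) := by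
  have hℓ : Tendsto (fun x : ℕ => Real.log x) atTop atTop :=
    Real.tendsto_log_atTop.comp tendsto_natCast_atTop_atTop
  have hℓ35 : Tendsto (fun x : ℕ => Real.log x ^ ((3 : ℝ) / 5)) atTop atTop :=
    (tendsto_rpow_atTop (by norm_num)).comp hℓ
  filter_upwards [eventually_ge_atTop 1, hℓ.eventually_ge_atTop 1,
    hℓ.eventually_ge_atTop (2 * |Real.log K| / ε), hℓ35.eventually_ge_atTop (2 * (K + 2) / ε)]
    with x hx1 hL1 hLK hL35 k hk2 hkL
  have hx0 : (0 : ℝ) < x := by exact_mod_cast (by omega : 0 < x)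
  set L := Real.log x with hLdef
  have hL0 : 0 < L := by linarith
  have hk1 : (1 : ℝ) ≤ k := by exact_mod_cast (by omega : 1 ≤ k)
  have hk0 : (0 : ℝ) < k := by linarith
  have hk2r : (2 : ℝ) ≤ k := by exact_mod_cast hk2
  -- k² ≤ L^{2/5}, k ≤ L^{2/5}
  have hL15 : 0 ≤ L ^ ((1 : ℝ) / 5) := Real.rpow_nonneg hL0.le _
  have hk2L : (k : ℝ) ^ 2 ≤ L ^ ((2 : ℝ) / 5) := by
    have := pow_le_pow_left₀ hk0.le hkL 2
    rw [show (L ^ ((1 : ℝ) / 5)) ^ 2 = L ^ ((2 : ℝ) / 5) by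
      rw [show ((L ^ ((1 : ℝ) / 5)) ^ 2) = (L ^ ((1 : ℝ) / 5)) ^ (2 : ℝ) by norm_cast,
        ← Real.rpow_mul hL0.le]; norm_num] at this
    exact this
  have hkL25 : (k : ℝ) ≤ L ^ ((2 : ℝ) / 5) := by nlinarith
  have hsplit : L ^ ((2 : ℝ) / 5) * L ^ ((3 : ℝ) / 5) = L := by
    rw [← Real.rpow_add hL0]; norm_num
  have hL25 : 0 ≤ L ^ ((2 : ℝ) / 5) := Real.rpow_nonneg hL0.le _
  -- main growth inequality: K k + |log K| + 2 k² ≤ ε L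
  have hmain : K * k + |Real.log K| + 2 * (k : ℝ) ^ 2 ≤ ε * L := by
    have h1 : (K + 2) * L ^ ((2 : ℝ) / 5) ≤ ε * L / 2 := by
      have hK2 : (0 : ℝ) < K + 2 := by linarith
      have : (K + 2) * L ^ ((2 : ℝ) / 5) * (2 * (K + 2) / ε) ≤
          (K + 2) * L ^ ((2 : ℝ) / 5) * L ^ ((3 : ℝ) / 5) :=
        mul_le_mul_of_nonneg_left hL35 (by positivity)
      rw [mul_assoc (K + 2) (L ^ ((2 : ℝ) / 5)) (L ^ ((3 : ℝ) / 5)), hsplit] at this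
      have h1' := div_le_div_of_nonneg_right this (by positivity : (0 : ℝ) ≤ 2 * (K + 2))
      have e1 : (K + 2) * L ^ ((2 : ℝ) / 5) * (2 * (K + 2) / ε) / (2 * (K + 2)) =
          (K + 2) * L ^ ((2 : ℝ) / 5) / ε := by
        field_simp
      have e2 : (K + 2) * L / (2 * (K + 2)) = L / 2 := by
        field_simp
      rw [e1, e2, div_le_iff₀ hε] at h1'
      linarith
    have h2 : |Real.log K| ≤ ε * L / 2 := by
      have := hLK
      rw [div_le_iff₀ hε] at this
      linarith
    nlinarith
  -- log of the right-hand side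
  have hlogk : Real.log k ≤ k - 1 := Real.log_le_sub_one_of_pos hk0
  have hlogk0 : 0 < Real.log k := Real.log_pos (by linarith)
  have hP0 : 0 < 2 * (k : ℝ) * Real.log k := by positivity
  have hlogP : Real.log (2 * (k : ℝ) * Real.log k) ≤ 2 * k := by
    have h1 : 2 * (k : ℝ) * Real.log k ≤ 2 * (k : ℝ) ^ 2 := by nlinarith
    have h2 : Real.log (2 * (k : ℝ) ^ 2) = Real.log 2 + 2 * Real.log k := by
      rw [Real.log_mul (by norm_num) (by positivity), Real.log_pow]; ring
    have h3 := Real.log_le_log hP0 h1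
    have h4 := Real.log_two_lt_d9
    linarith
  have hklogP : (k : ℝ) * Real.log (2 * (k : ℝ) * Real.log k) ≤ 2 * (k : ℝ) ^ 2 := by
    nlinarith
  have hR : 2 * Real.exp (-(K * k)) * (K⁻¹ * (2 * (k : ℝ) * Real.log k) ^ (-(k : ℝ))) =
      Real.exp (Real.log 2 - K * k - Real.log K - k * Real.log (2 * (k : ℝ) * Real.log k)) := by
    rw [Real.rpow_def_of_pos hP0,
      show Real.log 2 - K * k - Real.log K - k * Real.log (2 * (k : ℝ) * Real.log k) =
        Real.log 2 + (-(K * k)) + (-Real.log K + Real.log (2 * (k : ℝ) * Real.log k) * (-(k : ℝ))) by ring,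
      Real.exp_add, Real.exp_add, Real.exp_add, Real.exp_log two_pos, Real.exp_neg (Real.log K),
      Real.exp_log hK]
  rw [Real.rpow_def_of_pos hx0, hR, Real.exp_le_exp]
  have h2 : 0 ≤ Real.log 2 := Real.log_nonneg (by norm_num)
  have hKabs : Real.log K ≤ |Real.log K| := le_abs_self _
  rw [← hLdef]
  nlinarith

/-! ### (6.6) from (7.15) -/

/-- **(6.6) from (7.15) at `X = x/2`**: `(x/2)^{2/9+ε} ≤ x^{1/3+ε}` for `x ≥ 1`, `ε ≥ 0`.
[cite: FordGreenKonyaginMaynardTao2018, §8 p. 23 («from (7.15) we have (6.6)»)] -/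
theorem rpow_half_le {x ε : ℝ} (hx : 1 ≤ x) (hε : 0 ≤ ε) :
    (x / 2) ^ ((2 : ℝ) / 9 + ε) ≤ x ^ ((1 : ℝ) / 3 + ε) := by
  have h1 : (x / 2) ^ ((2 : ℝ) / 9 + ε) ≤ x ^ ((2 : ℝ) / 9 + ε) :=
    Real.rpow_le_rpow (by positivity) (by linarith) (by positivity)
  exact h1.trans (Real.rpow_le_rpow_of_exponent_le hx (by norm_num))

end Literature.NumberTheory.Sieve.FGKMT2018
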